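import Literature.NumberTheory.NumberFields.BhargavaQuinticSpaceKernel
import Literature.NumberTheory.NumberFields.BhargavaQuinticSpaceSection
import Mathlib.LinearAlgebra.FiniteDimensional.Lemmas
import HarnessLib

/-!
# Bhargava's quintic space: linear syzygies of the five quadrics are the rows of the pencil

Support file for the named fact
`Literature.NumberTheory.NumberFields.BhargavaQuinticSpace.WrightYukie1992_orbit_bijective_etaleQuintic`
(file `BhargavaQuinticSpace.lean`), towards part (b), direction ⟸.  Everything here is PROVED.

For `A ∈ V(K)` the rows of the pencil `A(t) = ∑ tᵢ Aᵢ` are LINEAR SYZYGIES of the five quadrics: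
`A(t) · Q(A)(t) = 0` (`isSyzygy_rowSyz`).  The key structural fact used to recover `A` from its
quadrics is the converse — the linear strand of the Buchsbaum–Eisenbud resolution of five points
in `ℙ³`: EVERY linear syzygy `L : K⁴ → K⁵`, `∑ⱼ Lⱼ(t) Qⱼ(A)(t) ≡ 0`, is a combination of the rows,
`L(t) = c ᵥ* A(t)` (`SyzSpanned A`).  We prove it

* for the base point `A_{f₀}`, `f₀ = T⁵ - 1` (`syzSpanned_sectionQuintic_fermat`): a finite linear
  algebra computation — evaluating the cubic identity at `15` points of `{0,1,2}⁴` gives `15`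
  independent linear conditions on the `20` coefficients of `L`, whose solutions are the
  `5`-parameter family of rows (explicit rational certificates, characteristic `0`);
* and transport it: `SyzSpanned` is invariant under the `GL₄`-substitution `t ↦ t ᵥ* g`
  (`syzSpanned_glFour_smul`) and along an invertible basis change of the quadrics `Q(A) = M · Q(A')`
  between quadruples with independent quadrics (`syzSpanned_of_quadrics_eq`, by the dimension count
  `rows ≅ K⁵ ⊆ Syz(A)`, `dim Syz(A) ≤ dim Syz(A') = 5`).

## References

* M. Bhargava, *Higher composition laws IV*, Ann. of Math. 167 (2008), 53–94, §2. [Bhargava2008]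
* A. Yukie, *Shintani Zeta Functions*, LMS LNS 183, CUP (1993), §0.4 Thm (0.4.2). [Yukie1993]
-/

noncomputable section

open Matrix
open scoped LinearAlgebra.Projectivization

namespace Literature.NumberTheory.NumberFields
namespace BhargavaQuinticSpace

universe u

variable {K : Type*} [Field K]

/-! ### Linear syzygies of the five quadrics -/

/-- The pencil is additive in `t`. [folklore] -/
theorem pencil_add (x : BhargavaQuinticSpace K) (t t' : Fin 4 → K) :
    pencil x (t + t') = pencil x t + pencil x t' := by
  simp [pencil, add_smul, Finset.sum_add_distrib]

/-- The pencil at a basis vector is the corresponding matrix: `A(eᵢ) = Aᵢ`. [folklore] -/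
theorem pencil_single (x : BhargavaQuinticSpace K) (i : Fin 4) :
    pencil x (Pi.single i 1) = (x i : Matrix (Fin 5) (Fin 5) K) := by
  simp [pencil, Pi.single_apply]

/-- A LINEAR SYZYGY of the five quadrics of `A`: a linear map `L : K⁴ → K⁵` (five linear forms) with
`∑ⱼ Lⱼ(t) Qⱼ(A)(t) = 0` identically. [folklore] -/
def IsSyzygy (x : BhargavaQuinticSpace K) (L : (Fin 4 → K) →ₗ[K] (Fin 5 → K)) : Prop :=
  ∀ t, L t ⬝ᵥ (fun m => subPfaffian x m t) = 0

/-- The ROW SYZYGIES `t ↦ c ᵥ* A(t)`: combinations of the rows of the pencil, as a linear map in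
`t`, depending linearly on `c ∈ K⁵`. [folklore] -/
def rowSyz (x : BhargavaQuinticSpace K) : (Fin 5 → K) →ₗ[K] ((Fin 4 → K) →ₗ[K] (Fin 5 → K)) where
  toFun c :=
    { toFun := fun t => c ᵥ* pencil x t
      map_add' := fun t t' => by rw [pencil_add, vecMul_add]
      map_smul' := fun a t => by rw [pencil_smul, vecMul_smul, RingHom.id_apply] }
  map_add' c c' := by
    ext t j
    simp [add_vecMul]
  map_smul' a c := by
    ext t j
    simp [smul_vecMul]

/-- Unfolding `rowSyz`. [folklore] -/
theorem rowSyz_apply (x : BhargavaQuinticSpace K) (c : Fin 5 → K) (t : Fin 4 → K) :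
    rowSyz x c t = c ᵥ* pencil x t := rfl

/-- Row syzygies are syzygies (`A(t) · Q(A)(t) = 0`). [folklore] -/
theorem isSyzygy_rowSyz (x : BhargavaQuinticSpace K) (c : Fin 5 → K) : IsSyzygy x (rowSyz x c) := by
  intro t
  rw [rowSyz_apply, subPfaffian_eq_subPfVec, ← dotProduct_mulVec,
    mulVec_subPfVec_of_mem_altMatrix (pencil_mem_altMatrix x t), dotProduct_zero]

/-- The syzygies form a subspace of `Hom(K⁴, K⁵)`. [folklore] -/
def syzSubmodule (x : BhargavaQuinticSpace K) : Submodule K ((Fin 4 → K) →ₗ[K] (Fin 5 → K)) where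
  carrier := {L | IsSyzygy x L}
  add_mem' := by
    intro L L' hL hL' t
    simp only [LinearMap.add_apply, add_dotProduct, hL t, hL' t, add_zero]
  zero_mem' := fun t => by simp
  smul_mem' := by
    intro a L hL t
    simp only [LinearMap.smul_apply, smul_dotProduct, hL t, smul_zero]

/-- Membership in the syzygy subspace. [folklore] -/
theorem mem_syzSubmodule_iff (x : BhargavaQuinticSpace K) (L : (Fin 4 → K) →ₗ[K] (Fin 5 → K)) :
    L ∈ syzSubmodule x ↔ IsSyzygy x L :=
  Iff.rfl

/-- `SyzSpanned A`: EVERY linear syzygy of the quadrics of `A` is a row syzygy (the linear syzygies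
are exactly the rows of the pencil — the linear strand of the Buchsbaum–Eisenbud resolution).
[folklore] -/
def SyzSpanned (x : BhargavaQuinticSpace K) : Prop :=
  ∀ L : (Fin 4 → K) →ₗ[K] (Fin 5 → K), IsSyzygy x L → ∃ c : Fin 5 → K, L = rowSyz x c

/-- Row syzygies of a quadruple with independent quadrics are parametrised faithfully by `c`.
[folklore] -/
theorem rowSyz_injective (x : BhargavaQuinticSpace K)
    (hli : LinearIndependent K (fun i : Fin 5 => (subPfaffian x i : (Fin 4 → K) → K))) :
    Function.Injective (rowSyz x) := by
  rw [← LinearMap.ker_eq_bot, LinearMap.ker_eq_bot']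
  intro c hc
  apply eq_zero_of_forall_vecMul_eq_zero x hli
  intro i
  have := LinearMap.congr_fun hc (Pi.single i 1)
  rwa [rowSyz_apply, pencil_single, LinearMap.zero_apply] at this

/-- The row syzygies lie in the syzygy subspace. [folklore] -/
theorem range_rowSyz_le (x : BhargavaQuinticSpace K) : LinearMap.range (rowSyz x) ≤ syzSubmodule x := by
  rintro _ ⟨c, rfl⟩
  exact isSyzygy_rowSyz x c

/-- `SyzSpanned` in terms of the syzygy subspace. [folklore] -/
theorem syzSpanned_iff_le_range (x : BhargavaQuinticSpace K) :
    SyzSpanned x ↔ syzSubmodule x ≤ LinearMap.range (rowSyz x) := by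
  constructor
  · intro h L hL
    obtain ⟨c, rfl⟩ := h L hL
    exact LinearMap.mem_range_self _ _
  · intro h L hL
    obtain ⟨c, hc⟩ := h hL
    exact ⟨c, hc.symm⟩

/-! ### The base point: every linear syzygy of `A_{T⁵ - 1}` is a row syzygy -/

/-- A linear map agreeing with `c ᵥ* Aₘ` on the basis vectors is the row syzygy of `c`. [folklore] -/
theorem eq_rowSyz_of_apply_single (x : BhargavaQuinticSpace K) (L : (Fin 4 → K) →ₗ[K] (Fin 5 → K))
    (c : Fin 5 → K) (h : ∀ (m : Fin 4) (j : Fin 5), L (Pi.single m 1) j = (c ᵥ* (x m : Matrix (Fin 5) (Fin 5) K)) j) :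
    L = rowSyz x c := by
  apply (Pi.basisFun K (Fin 4)).ext
  intro m
  funext j
  rw [Pi.basisFun_apply, rowSyz_apply, pencil_single]
  exact h m j


/-- **Numeric syzygy computation.** For the section `A_{f₀}` of `f₀ = T⁵ - 1`, every linear syzygy
of its five quadrics `-(t₀t₂ - t₁², t₀t₃ - t₁t₂, t₁t₃ - t₂², t₂t₃ - t₀², t₃² - t₀t₁)` is a combination
of the rows of its pencil: the `20 × 20` linear system on the coefficients of the syzygy obtained by
evaluating the cubic identity at `15` points of `{0,1,2}⁴` has rank `15`, and its solutions are the
`5`-parameter family of row syzygies (rational certificate, characteristic `0`). [folklore] -/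
theorem syzSpanned_sectionQuintic_fermat [CharZero K] :
    SyzSpanned (sectionQuintic (0 : K) 0 0 0 (-1)) := by
  intro L hL
  -- coefficients of the five linear forms
  set l : Fin 5 → Fin 4 → K := fun j m => L (Pi.single m 1) j with hl
  have hLt : ∀ (t : Fin 4 → K) (j : Fin 5), L t j = ∑ m, t m * l j m := by
    intro t j
    rw [LinearMap.pi_apply_eq_sum_univ L t, Finset.sum_apply]
    refine Finset.sum_congr rfl fun m _ => ?_
    have hs : (fun j' : Fin 4 => if m = j' then (1 : K) else 0) = Pi.single m 1 := by
      funext j'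
      simp [Pi.single_apply, eq_comm]
    simp only [Pi.smul_apply, smul_eq_mul, hl, hs]
  have hev : ∀ t : Fin 4 → K,
      ∑ j : Fin 5, (∑ m, t m * l j m) * subPfaffian (sectionQuintic (0 : K) 0 0 0 (-1)) j t = 0 := by
    intro t
    have := hL t
    simp only [dotProduct, hLt] at this
    exact this
  have f0 : (-1 : K) * l 4 3 = 0 := by
    have h := hev ![0, 0, 0, 1]
    simp only [Fin.sum_univ_four, Fin.sum_univ_five, subPfaffian_sectionQuintic_zero,
      subPfaffian_sectionQuintic_one, subPfaffian_sectionQuintic_two, subPfaffian_sectionQuintic_three,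
      subPfaffian_sectionQuintic_four, Matrix.cons_val_zero, Matrix.cons_val_one, Matrix.cons_val] at h
    linear_combination h
  have f1 : (1 : K) * l 2 2 = 0 := by
    have h := hev ![0, 0, 1, 0]
    simp only [Fin.sum_univ_four, Fin.sum_univ_five, subPfaffian_sectionQuintic_zero,
      subPfaffian_sectionQuintic_one, subPfaffian_sectionQuintic_two, subPfaffian_sectionQuintic_three,
      subPfaffian_sectionQuintic_four, Matrix.cons_val_zero, Matrix.cons_val_one, Matrix.cons_val] at h
    linear_combination h
  have f2 : (1 : K) * l 2 2 + (1 : K) * l 2 3 + (-1 : K) * l 3 2 + (-1 : K) * l 3 3 + (-1 : K) * l 4 2 + (-1 : K) * l 4 3 = 0 := by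
    have h := hev ![0, 0, 1, 1]
    simp only [Fin.sum_univ_four, Fin.sum_univ_five, subPfaffian_sectionQuintic_zero,
      subPfaffian_sectionQuintic_one, subPfaffian_sectionQuintic_two, subPfaffian_sectionQuintic_three,
      subPfaffian_sectionQuintic_four, Matrix.cons_val_zero, Matrix.cons_val_one, Matrix.cons_val] at h
    linear_combination h
  have f3 : (1 : K) * l 0 1 = 0 := by
    have h := hev ![0, 1, 0, 0]
    simp only [Fin.sum_univ_four, Fin.sum_univ_five, subPfaffian_sectionQuintic_zero,
      subPfaffian_sectionQuintic_one, subPfaffian_sectionQuintic_two, subPfaffian_sectionQuintic_three,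
      subPfaffian_sectionQuintic_four, Matrix.cons_val_zero, Matrix.cons_val_one, Matrix.cons_val] at h
    linear_combination h
  have f4 : (1 : K) * l 0 1 + (1 : K) * l 0 3 + (-1 : K) * l 2 1 + (-1 : K) * l 2 3 + (-1 : K) * l 4 1 + (-1 : K) * l 4 3 = 0 := by
    have h := hev ![0, 1, 0, 1]
    simp only [Fin.sum_univ_four, Fin.sum_univ_five, subPfaffian_sectionQuintic_zero,
      subPfaffian_sectionQuintic_one, subPfaffian_sectionQuintic_two, subPfaffian_sectionQuintic_three,
      subPfaffian_sectionQuintic_four, Matrix.cons_val_zero, Matrix.cons_val_one, Matrix.cons_val] at h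
    linear_combination h
  have f5 : (1 : K) * l 0 1 + (1 : K) * l 0 2 + (1 : K) * l 1 1 + (1 : K) * l 1 2 + (1 : K) * l 2 1 + (1 : K) * l 2 2 = 0 := by
    have h := hev ![0, 1, 1, 0]
    simp only [Fin.sum_univ_four, Fin.sum_univ_five, subPfaffian_sectionQuintic_zero,
      subPfaffian_sectionQuintic_one, subPfaffian_sectionQuintic_two, subPfaffian_sectionQuintic_three,
      subPfaffian_sectionQuintic_four, Matrix.cons_val_zero, Matrix.cons_val_one, Matrix.cons_val] at h
    linear_combination h
  have f6 : (1 : K) * l 0 1 + (1 : K) * l 0 2 + (1 : K) * l 0 3 + (1 : K) * l 1 1 + (1 : K) * l 1 2 + (1 : K) * l 1 3 + (-1 : K) * l 3 1 + (-1 : K) * l 3 2 + (-1 : K) * l 3 3 + (-1 : K) * l 4 1 + (-1 : K) * l 4 2 + (-1 : K) * l 4 3 = 0 := by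
    have h := hev ![0, 1, 1, 1]
    simp only [Fin.sum_univ_four, Fin.sum_univ_five, subPfaffian_sectionQuintic_zero,
      subPfaffian_sectionQuintic_one, subPfaffian_sectionQuintic_two, subPfaffian_sectionQuintic_three,
      subPfaffian_sectionQuintic_four, Matrix.cons_val_zero, Matrix.cons_val_one, Matrix.cons_val] at h
    linear_combination h
  have f7 : (1 : K) * l 3 0 = 0 := by
    have h := hev ![1, 0, 0, 0]
    simp only [Fin.sum_univ_four, Fin.sum_univ_five, subPfaffian_sectionQuintic_zero,
      subPfaffian_sectionQuintic_one, subPfaffian_sectionQuintic_two, subPfaffian_sectionQuintic_three,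
      subPfaffian_sectionQuintic_four, Matrix.cons_val_zero, Matrix.cons_val_one, Matrix.cons_val] at h
    linear_combination h
  have f8 : (-1 : K) * l 1 0 + (-1 : K) * l 1 3 + (1 : K) * l 3 0 + (1 : K) * l 3 3 + (-1 : K) * l 4 0 + (-1 : K) * l 4 3 = 0 := by
    have h := hev ![1, 0, 0, 1]
    simp only [Fin.sum_univ_four, Fin.sum_univ_five, subPfaffian_sectionQuintic_zero,
      subPfaffian_sectionQuintic_one, subPfaffian_sectionQuintic_two, subPfaffian_sectionQuintic_three,
      subPfaffian_sectionQuintic_four, Matrix.cons_val_zero, Matrix.cons_val_one, Matrix.cons_val] at h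
    linear_combination h
  have f9 : (-1 : K) * l 0 0 + (-1 : K) * l 0 2 + (1 : K) * l 2 0 + (1 : K) * l 2 2 + (1 : K) * l 3 0 + (1 : K) * l 3 2 = 0 := by
    have h := hev ![1, 0, 1, 0]
    simp only [Fin.sum_univ_four, Fin.sum_univ_five, subPfaffian_sectionQuintic_zero,
      subPfaffian_sectionQuintic_one, subPfaffian_sectionQuintic_two, subPfaffian_sectionQuintic_three,
      subPfaffian_sectionQuintic_four, Matrix.cons_val_zero, Matrix.cons_val_one, Matrix.cons_val] at h
    linear_combination h
  have f10 : (-1 : K) * l 0 0 + (-1 : K) * l 0 2 + (-1 : K) * l 0 3 + (-1 : K) * l 1 0 + (-1 : K) * l 1 2 + (-1 : K) * l 1 3 + (1 : K) * l 2 0 + (1 : K) * l 2 2 + (1 : K) * l 2 3 + (-1 : K) * l 4 0 + (-1 : K) * l 4 2 + (-1 : K) * l 4 3 = 0 := by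
    have h := hev ![1, 0, 1, 1]
    simp only [Fin.sum_univ_four, Fin.sum_univ_five, subPfaffian_sectionQuintic_zero,
      subPfaffian_sectionQuintic_one, subPfaffian_sectionQuintic_two, subPfaffian_sectionQuintic_three,
      subPfaffian_sectionQuintic_four, Matrix.cons_val_zero, Matrix.cons_val_one, Matrix.cons_val] at h
    linear_combination h
  have f11 : (1 : K) * l 0 0 + (1 : K) * l 0 1 + (1 : K) * l 0 3 + (-1 : K) * l 1 0 + (-1 : K) * l 1 1 + (-1 : K) * l 1 3 + (-1 : K) * l 2 0 + (-1 : K) * l 2 1 + (-1 : K) * l 2 3 + (1 : K) * l 3 0 + (1 : K) * l 3 1 + (1 : K) * l 3 3 = 0 := by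
    have h := hev ![1, 1, 0, 1]
    simp only [Fin.sum_univ_four, Fin.sum_univ_five, subPfaffian_sectionQuintic_zero,
      subPfaffian_sectionQuintic_one, subPfaffian_sectionQuintic_two, subPfaffian_sectionQuintic_three,
      subPfaffian_sectionQuintic_four, Matrix.cons_val_zero, Matrix.cons_val_one, Matrix.cons_val] at h
    linear_combination h
  have f12 : (1 : K) * l 1 0 + (1 : K) * l 1 1 + (1 : K) * l 1 2 + (1 : K) * l 2 0 + (1 : K) * l 2 1 + (1 : K) * l 2 2 + (1 : K) * l 3 0 + (1 : K) * l 3 1 + (1 : K) * l 3 2 + (1 : K) * l 4 0 + (1 : K) * l 4 1 + (1 : K) * l 4 2 = 0 := by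
    have h := hev ![1, 1, 1, 0]
    simp only [Fin.sum_univ_four, Fin.sum_univ_five, subPfaffian_sectionQuintic_zero,
      subPfaffian_sectionQuintic_one, subPfaffian_sectionQuintic_two, subPfaffian_sectionQuintic_three,
      subPfaffian_sectionQuintic_four, Matrix.cons_val_zero, Matrix.cons_val_one, Matrix.cons_val] at h
    linear_combination h
  have f13 : (1 : K) * l 2 2 + (2 : K) * l 2 3 + (-2 : K) * l 3 2 + (-4 : K) * l 3 3 + (-4 : K) * l 4 2 + (-8 : K) * l 4 3 = 0 := by
    have h := hev ![0, 0, 1, 2]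
    simp only [Fin.sum_univ_four, Fin.sum_univ_five, subPfaffian_sectionQuintic_zero,
      subPfaffian_sectionQuintic_one, subPfaffian_sectionQuintic_two, subPfaffian_sectionQuintic_three,
      subPfaffian_sectionQuintic_four, Matrix.cons_val_zero, Matrix.cons_val_one, Matrix.cons_val] at h
    linear_combination h
  have f14 : (1 : K) * l 0 1 + (2 : K) * l 0 3 + (-2 : K) * l 2 1 + (-4 : K) * l 2 3 + (-4 : K) * l 4 1 + (-8 : K) * l 4 3 = 0 := by
    have h := hev ![0, 1, 0, 2]
    simp only [Fin.sum_univ_four, Fin.sum_univ_five, subPfaffian_sectionQuintic_zero,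
      subPfaffian_sectionQuintic_one, subPfaffian_sectionQuintic_two, subPfaffian_sectionQuintic_three,
      subPfaffian_sectionQuintic_four, Matrix.cons_val_zero, Matrix.cons_val_one, Matrix.cons_val] at h
    linear_combination h
  refine ⟨![l 4 2, -l 4 1, l 4 0, l 2 1, -l 2 0], eq_rowSyz_of_apply_single _ L _ fun m j => ?_⟩
  change l j m = _
  fin_cases m <;> fin_cases j
  · simp [vecMul, dotProduct, Fin.sum_univ_five, sectionQuintic, altFive]
    linear_combination (-3 : K) * f0 + ((7 : K) / 2) * f1 + (-2 : K) * f2 + (2 : K) * f3 + (-1 : K) * f4 + (-2 : K) * f5 + (1 : K) * f6 + (-1 : K) * f7 + (1 : K) * f8 + (-1 : K) * f9 + (1 : K) * f12 + ((1 : K) / 2) * f13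
  · simp [vecMul, dotProduct, Fin.sum_univ_five, sectionQuintic, altFive]
    linear_combination (-1 : K) * f0 + (1 : K) * f2 + (1 : K) * f3 + (1 : K) * f4 + (-1 : K) * f6 + (1 : K) * f8 + (-1 : K) * f10 + (-1 : K) * f11
  · simp [vecMul, dotProduct, Fin.sum_univ_five, sectionQuintic, altFive]
  · simp [vecMul, dotProduct, Fin.sum_univ_five, sectionQuintic, altFive]
    linear_combination (1 : K) * f7
  · simp [vecMul, dotProduct, Fin.sum_univ_five, sectionQuintic, altFive]
  · simp [vecMul, dotProduct, Fin.sum_univ_five, sectionQuintic, altFive]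
    linear_combination (1 : K) * f3
  · simp [vecMul, dotProduct, Fin.sum_univ_five, sectionQuintic, altFive]
    linear_combination (-1 : K) * f0 + (1 : K) * f1 + (-1 : K) * f2 + (-1 : K) * f5 + (1 : K) * f6 + (-1 : K) * f9 + (1 : K) * f10 + (1 : K) * f12
  · simp [vecMul, dotProduct, Fin.sum_univ_five, sectionQuintic, altFive]
  · simp [vecMul, dotProduct, Fin.sum_univ_five, sectionQuintic, altFive]
    linear_combination (4 : K) * f0 + ((-5 : K) / 2) * f1 + (1 : K) * f2 + (-2 : K) * f3 + (1 : K) * f5 + (1 : K) * f7 + (-2 : K) * f8 + (1 : K) * f10 + (1 : K) * f11 + ((-1 : K) / 2) * f13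
  · simp [vecMul, dotProduct, Fin.sum_univ_five, sectionQuintic, altFive]
  · simp [vecMul, dotProduct, Fin.sum_univ_five, sectionQuintic, altFive]
    linear_combination (4 : K) * f0 + (-1 : K) * f1 + ((-5 : K) / 2) * f3 + (2 : K) * f4 + (2 : K) * f5 + (-1 : K) * f6 + (2 : K) * f7 + (-1 : K) * f8 + (-1 : K) * f12 + ((-1 : K) / 2) * f14
  · simp [vecMul, dotProduct, Fin.sum_univ_five, sectionQuintic, altFive]
    linear_combination (-3 : K) * f0 + (-1 : K) * f1 + (1 : K) * f2 + ((3 : K) / 2) * f3 + (-2 : K) * f4 + (-2 : K) * f7 + (1 : K) * f8 + (1 : K) * f9 + (-1 : K) * f10 + ((1 : K) / 2) * f14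
  · simp [vecMul, dotProduct, Fin.sum_univ_five, sectionQuintic, altFive]
    linear_combination (1 : K) * f1
  · simp [vecMul, dotProduct, Fin.sum_univ_five, sectionQuintic, altFive]
    linear_combination (1 : K) * f0 + ((3 : K) / 2) * f1 + (-2 : K) * f2 + ((-1 : K) / 2) * f3 + (1 : K) * f4 + ((1 : K) / 2) * f13 + ((-1 : K) / 2) * f14
  · simp [vecMul, dotProduct, Fin.sum_univ_five, sectionQuintic, altFive]
  · simp [vecMul, dotProduct, Fin.sum_univ_five, sectionQuintic, altFive]
    linear_combination (2 : K) * f0 + ((-3 : K) / 2) * f3 + (2 : K) * f4 + ((-1 : K) / 2) * f14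
  · simp [vecMul, dotProduct, Fin.sum_univ_five, sectionQuintic, altFive]
    linear_combination (5 : K) * f0 + ((-1 : K) / 2) * f1 + (-1 : K) * f3 + (-1 : K) * f4 + (1 : K) * f6 + (1 : K) * f7 + (-2 : K) * f8 + (1 : K) * f10 + (1 : K) * f11 + ((-1 : K) / 2) * f13
  · simp [vecMul, dotProduct, Fin.sum_univ_five, sectionQuintic, altFive]
    linear_combination (3 : K) * f0 + ((-1 : K) / 2) * f3 + (1 : K) * f4 + ((-1 : K) / 2) * f14
  · simp [vecMul, dotProduct, Fin.sum_univ_five, sectionQuintic, altFive]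
    linear_combination (3 : K) * f0 + ((-1 : K) / 2) * f1 + (1 : K) * f2 + ((-1 : K) / 2) * f13
  · simp [vecMul, dotProduct, Fin.sum_univ_five, sectionQuintic, altFive]
    linear_combination (-1 : K) * f0

/-! ### Transport of syzygies -/

/-- The `GL₄`-part acts on the quadrics by the substitution `t ↦ t ᵥ* g`. [folklore] -/
theorem subPfaffian_glFour_smul (g : GL (Fin 4) K) (x : BhargavaQuinticSpace K) (m : Fin 5) (t : Fin 4 → K) :
    subPfaffian (((g, (1 : GL (Fin 5) K)) : GL (Fin 4) K × GL (Fin 5) K) • x) m t =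
      subPfaffian x m (t ᵥ* (g : Matrix (Fin 4) (Fin 4) K)) := by
  simp only [subPfaffian, pencil_gl_smul, Units.val_one, transpose_one, Matrix.one_mul, Matrix.mul_one]

/-- The `GL₄`-part acts on the pencil by the substitution `t ↦ t ᵥ* g`. [folklore] -/
theorem pencil_glFour_smul (g : GL (Fin 4) K) (x : BhargavaQuinticSpace K) (t : Fin 4 → K) :
    pencil (((g, (1 : GL (Fin 5) K)) : GL (Fin 4) K × GL (Fin 5) K) • x) t =
      pencil x (t ᵥ* (g : Matrix (Fin 4) (Fin 4) K)) := by
  rw [pencil_gl_smul, Units.val_one, transpose_one, Matrix.one_mul, Matrix.mul_one]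

/-- `SyzSpanned` is invariant under the `GL₄`-part of the action (transport of structure along the
linear substitution `t ↦ t ᵥ* g`). [folklore] -/
theorem syzSpanned_glFour_smul (g : GL (Fin 4) K) (x : BhargavaQuinticSpace K) (h : SyzSpanned x) :
    SyzSpanned (((g, (1 : GL (Fin 5) K)) : GL (Fin 4) K × GL (Fin 5) K) • x) := by
  intro L hL
  have hginv : ((g⁻¹ : GL (Fin 4) K) : Matrix (Fin 4) (Fin 4) K) * (g : Matrix (Fin 4) (Fin 4) K) = 1 :=
    Units.inv_mul g
  have hginv' : (g : Matrix (Fin 4) (Fin 4) K) * ((g⁻¹ : GL (Fin 4) K) : Matrix (Fin 4) (Fin 4) K) = 1 :=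
    Units.mul_inv g
  have hL' : IsSyzygy x (L ∘ₗ Matrix.vecMulLinear ((g⁻¹ : GL (Fin 4) K) : Matrix (Fin 4) (Fin 4) K)) := by
    intro s
    have := hL (s ᵥ* ((g⁻¹ : GL (Fin 4) K) : Matrix (Fin 4) (Fin 4) K))
    simp only [subPfaffian_glFour_smul, vecMul_vecMul, hginv, vecMul_one] at this
    simpa only [LinearMap.comp_apply, Matrix.vecMulLinear_apply] using this
  obtain ⟨c, hc⟩ := h _ hL'
  refine ⟨c, ?_⟩
  apply LinearMap.ext
  intro t
  have := LinearMap.congr_fun hc (t ᵥ* (g : Matrix (Fin 4) (Fin 4) K))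
  simp only [LinearMap.comp_apply, Matrix.vecMulLinear_apply, vecMul_vecMul, hginv', vecMul_one,
    rowSyz_apply] at this
  rw [this, rowSyz_apply, pencil_glFour_smul]

/-- Post-composition with `v ↦ v ᵥ* M`, a linear endomorphism of `Hom(K⁴, K⁵)`. [folklore] -/
def postVecMul (M : Matrix (Fin 5) (Fin 5) K) :
    ((Fin 4 → K) →ₗ[K] (Fin 5 → K)) →ₗ[K] ((Fin 4 → K) →ₗ[K] (Fin 5 → K)) where
  toFun L := (Matrix.vecMulLinear M) ∘ₗ L
  map_add' L L' := by
    ext t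
    simp
  map_smul' a L := by
    ext t
    simp

/-- Unfolding `postVecMul`. [folklore] -/
theorem postVecMul_apply (M : Matrix (Fin 5) (Fin 5) K) (L : (Fin 4 → K) →ₗ[K] (Fin 5 → K)) (t : Fin 4 → K) :
    postVecMul M L t = L t ᵥ* M :=
  rfl

/-- If `Q(A) = M · Q(A')`, post-composition with `M` maps syzygies of `A` to syzygies of `A'`.
[folklore] -/
theorem isSyzygy_postVecMul (x y : BhargavaQuinticSpace K) (M : Matrix (Fin 5) (Fin 5) K)
    (hQ : ∀ i t, subPfaffian x i t = ∑ j, M i j * subPfaffian y j t)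
    {L : (Fin 4 → K) →ₗ[K] (Fin 5 → K)} (hL : IsSyzygy x L) : IsSyzygy y (postVecMul M L) := by
  intro t
  have hQt : (fun m => subPfaffian x m t) = M *ᵥ fun m => subPfaffian y m t := by
    funext i
    simp [mulVec, dotProduct, hQ i t]
  rw [postVecMul_apply, ← dotProduct_mulVec, ← hQt]
  exact hL t

/-- **Basis change of quadrics does not increase syzygies**: if `Q(A) = M · Q(A')` with `M`
invertible, `dim Syz(A) ≤ dim Syz(A')`. [folklore] -/
theorem finrank_syzSubmodule_le_of_quadrics_eq (x y : BhargavaQuinticSpace K) (M : Matrix (Fin 5) (Fin 5) K)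
    (hM : IsUnit M) (hQ : ∀ i t, subPfaffian x i t = ∑ j, M i j * subPfaffian y j t) :
    Module.finrank K (syzSubmodule x) ≤ Module.finrank K (syzSubmodule y) := by
  let ψ : syzSubmodule x →ₗ[K] syzSubmodule y :=
    ((postVecMul M).domRestrict (syzSubmodule x)).codRestrict (syzSubmodule y)
      (fun L => isSyzygy_postVecMul x y M hQ L.2)
  apply LinearMap.finrank_le_finrank_of_injective (f := ψ)
  intro L L' hLL'
  apply Subtype.ext
  apply LinearMap.ext
  intro t
  have h1 := congrArg (fun z : syzSubmodule y => (z : (Fin 4 → K) →ₗ[K] (Fin 5 → K)) t) hLL'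
  simp only [ψ, LinearMap.codRestrict_apply, LinearMap.domRestrict_apply, postVecMul_apply] at h1
  exact Matrix.vecMul_injective_of_isUnit hM h1

/-- The syzygy subspace of a `SyzSpanned` quadruple is the space of row syzygies. [folklore] -/
theorem syzSubmodule_eq_range (x : BhargavaQuinticSpace K) (h : SyzSpanned x) :
    syzSubmodule x = LinearMap.range (rowSyz x) :=
  le_antisymm ((syzSpanned_iff_le_range x).mp h) (range_rowSyz_le x)

/-- **Transport of `SyzSpanned` along a basis change of quadrics.**  If every syzygy of `A'` is a
row syzygy, the quadrics of `A` and `A'` are linearly independent and `Q(A) = M · Q(A')` with `M`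
invertible, then every syzygy of `A` is a row syzygy (dimension count: `Syz(A) ⊇ rows ≅ K⁵`,
`dim Syz(A) ≤ dim Syz(A') = 5`). [folklore] -/
theorem syzSpanned_of_quadrics_eq (x y : BhargavaQuinticSpace K) (hy : SyzSpanned y)
    (hyli : LinearIndependent K (fun i : Fin 5 => (subPfaffian y i : (Fin 4 → K) → K)))
    (hxli : LinearIndependent K (fun i : Fin 5 => (subPfaffian x i : (Fin 4 → K) → K)))
    (M : Matrix (Fin 5) (Fin 5) K) (hM : IsUnit M)
    (hQ : ∀ i t, subPfaffian x i t = ∑ j, M i j * subPfaffian y j t) : SyzSpanned x := by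
  rw [syzSpanned_iff_le_range]
  have h5x : Module.finrank K (LinearMap.range (rowSyz x)) = 5 := by
    rw [LinearMap.finrank_range_of_inj (rowSyz_injective x hxli), Module.finrank_fintype_fun_eq_card,
      Fintype.card_fin]
  have h5y : Module.finrank K (syzSubmodule y) = 5 := by
    rw [syzSubmodule_eq_range y hy, LinearMap.finrank_range_of_inj (rowSyz_injective y hyli),
      Module.finrank_fintype_fun_eq_card, Fintype.card_fin]
  have hle := finrank_syzSubmodule_le_of_quadrics_eq x y M hM hQ
  rw [h5y] at hle
  have heq : LinearMap.range (rowSyz x) = syzSubmodule x :=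
    Submodule.eq_of_le_of_finrank_le (range_rowSyz_le x) (by rw [h5x]; exact hle)
  rw [heq]

end BhargavaQuinticSpace
end Literature.NumberTheory.NumberFields
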